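import Summits.PneNP.PneNP.Theorems.ChebyshevTracialDesignCrossingPlaneByType
import Summits.PneNP.PneNP.Theorems.ChebyshevTracialDesignGammaDirectionReduction
import HarnessLib

/-!
# Cell pnp-psdrank, route `ChebyshevTracialDesign`: the γ-direction's extended `x`-smoothness family, discharged by the `H`-type
# (crux `TracialDecayExp20`, stmt-PneNP-19878)

Brick 132 (prover g26; MEMO-29). Brick 129 (`abs_gammaDirection_value_add_newton_le`) takes ONE family of `x`-smoothness numbers `X_k` indexed by
`k ≤ D+1` deleted edge pairs, `r ≤ 2` pinned edges and `r ≤ s ≤ 2r` pinned vertices: ground sets `S′` with `|S′| + 4k + 2r = n`, cut `t − s − 2k`, window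
`[0, t−s]`, levels `c′ + 2k ≤ T` (brick 120's family is the sub-family `s = r`: half pins remove one vertex per edge; the full pins of the `n_A`-terms remove
two). Brick 125's `smoothnessFamily_le_of_type` discharges, from four margins on the `H`-type of `M`, the family with cut `t − e − 2k` on ground sets
`|S′| + 4k + 2e = n` for an ARBITRARY cut parameter `t`; applying it with `t − (s − r) ∈ {t, t−1, t−2}` in place of `t` and `e = r` gives every member of the
extended family, with the Chernoff exponent's `(t − T − 2)/2` weakened to `(t − T − 4)/2`:

* **`smoothnessFamilyRS_le_of_type`**: under brick 125's hypotheses (for the cut parameter `t`, `2 ≤ t`), for every `k ≤ D+1`, `r ≤ 2`, `r ≤ s ≤ 2r`,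
  `c′ + 2k ≤ T`, `π`-stable `S′` with `|S′| + 4k + 2r = n`:
  `Σ_{x=0}^{t−s} |(∇²)^k law_{S′}(t−s−2k,·)(c′)(x)| ≤ (2√192·√(4k/V₀))^{2k} + 4^k·exp((u+u²)·(t/2)·a/(n/2−T−2) − u·((t−T−4)/2+1−r₀))`.
So the γ-direction reduction has NO `x`-smoothness hypothesis left for non-aligned matchings, exactly as brick 125 did for brick 124; the asymptotic
numerics of bricks 126b/126 apply after replacing `T + 2` by `T + 4` in `chernoff_exponent_le`'s margin (`T + 4 ≤ β₀N`).
WHAT THIS FILE DOES NOT DO: the asymptotic assembly (analogue of bricks 126/127 for the γ-direction — it waits for the centred-moment [BULK], brick 130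
(ii)/(iii)), anything on `TracialDecayExp20` itself, psd rank of P_PM(K_n), or P vs NP.
[cite: Rothvoss2017, §2 (PDF p. 6)] [cite: RollinRoss2010, §4.1 Thm 4.2] [cite: Durrett2019, §2.7]
Stature: support/instrument (kernel lane, no defs, axioms standard). Supports stmt-PneNP-19878.
-/

set_option linter.dupNamespace false -- `Summit.PneNP.PneNP.…`: summit = sub-problem (D-0017)

noncomputable section

namespace Summit.PneNP.PneNP.Theorems.ChebyshevTracialDesignGammaDirectionByType

open Finset Polynomial Literature.Barriers.PneNP Literature.Combinatorics.Optimization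
open Literature.Combinatorics.Optimization.ShellStep
open Summit.PneNP.PneNP.Theorems.ChebyshevTracialDesignCrossingPlaneByType (smoothnessFamily_le_of_type)

variable {n : ℕ}

/-- **The extended `x`-smoothness family of brick 129, discharged by the `H`-type (brick 132).** For a perfect matching `M` (partner map `π`), a block `H`,
a cut parameter `t ≥ 2` and top level `T` with `t + T + 2 ≤ n`, `T + 2 < n/2`, parameters `β > 0`, `V₀ > 0` (`2(D+1) − 1 ≤ 2V₀`), `u ∈ [0,1]`, `r₀`, and brick 118's
four margins on the type of `M` (with `D+2` for `D+1`) — verbatim the hypotheses of brick 125 —: for every `k ≤ D+1`, `r ≤ 2`, `r ≤ s ≤ 2r`, level `c′` with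
`c′ + 2k ≤ T` and every `π`-stable `S′` with `|S′| + 4k + 2r = n`,
`Σ_{x=0}^{t−s} |(∇²)^k law_{S′}(t−s−2k,·)(c′)(x)| ≤ (2√192·√(4k/V₀))^{2k} + 4^k·exp((u+u²)·(t/2)·a/(n/2−T−2) − u·((t−T−4)/2+1−r₀))`
(`a` = number of `HH` edges of `M`; brick 125 at the cut parameter `t − (s−r)`, then monotonicity of the exponent).
[cite: Rothvoss2017, §2 (PDF p. 6)] [cite: RollinRoss2010, §4.1 Thm 4.2] [cite: Durrett2019, §2.7] -/
theorem smoothnessFamilyRS_le_of_type (M : PMatch n) (H : Finset (Fin n)) {t T D : ℕ} (ht2 : 2 ≤ t) (htn : t + T + 2 ≤ n)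
    {β V₀ u : ℝ} (hβ : 0 < β) (hV₀ : 0 < V₀) (hu0 : 0 ≤ u) (hu1 : u ≤ 1) (r₀ : ℕ)
    (hkV : (2 * (D + 1 : ℕ) : ℝ) - 1 ≤ 2 * V₀)
    (hbT : β * (((reps M.2.partner (vBH M.2.partner univ H ∪ vBN M.2.partner univ H)).card : ℝ) +
      (reps M.2.partner (vDD M.2.partner univ H)).card) + T + 2 * (D + 2) ≤
      (reps M.2.partner (vBH M.2.partner univ H ∪ vBN M.2.partner univ H)).card)
    (hdT : β * (((reps M.2.partner (vBH M.2.partner univ H ∪ vBN M.2.partner univ H)).card : ℝ) +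
      (reps M.2.partner (vDD M.2.partner univ H)).card) + T + 2 * (D + 2) ≤
      (reps M.2.partner (vDD M.2.partner univ H)).card)
    (hr₀ : β * (((reps M.2.partner (vBH M.2.partner univ H ∪ vBN M.2.partner univ H)).card : ℝ) +
      (reps M.2.partner (vDD M.2.partner univ H)).card) ≤ r₀)
    (hsT : (t : ℝ) / 2 +
      β * (((reps M.2.partner (vBH M.2.partner univ H ∪ vBN M.2.partner univ H)).card : ℝ) +
        (reps M.2.partner (vDD M.2.partner univ H)).card) + 2 * T + 4 * (D + 2) + 2 ≤
      ((reps M.2.partner (vBH M.2.partner univ H ∪ vBN M.2.partner univ H)).card : ℝ) +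
        (reps M.2.partner (vDD M.2.partner univ H)).card)
    (hV₀le : V₀ ≤ β ^ 4 * ((((reps M.2.partner (vBH M.2.partner univ H ∪ vBN M.2.partner univ H)).card : ℝ) +
      (reps M.2.partner (vDD M.2.partner univ H)).card) - 4 * (D + 2) - 2 * T))
    (hNT : (T : ℝ) + 2 < (n : ℝ) / 2) :
    ∀ k, k ≤ D + 1 → ∀ r s : ℕ, r ≤ 2 → r ≤ s → s ≤ 2 * r → ∀ c' : ℕ, c' + 2 * k ≤ T →
      ∀ S' : Finset (Fin n), (∀ v ∈ S', M.2.partner v ∈ S') → S'.card + 4 * k + 2 * r = n →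
      ∑ x ∈ Icc (0 : ℤ) ((t - s : ℕ) : ℤ),
        |nab2^[k] (fun c x => shellLaw M.2.partner S' H (t - s - 2 * k) c x : Profile) c' x| ≤
      (2 * Real.sqrt 192 * Real.sqrt (4 * k / V₀)) ^ (2 * k) +
        (4 : ℝ) ^ k * Real.exp ((u + u ^ 2) * ((t : ℝ) / 2 * (reps M.2.partner (vAA M.2.partner univ H)).card /
            ((n : ℝ) / 2 - T - 2)) - u * (((t : ℝ) - T - 4) / 2 + 1 - r₀)) := by
  intro k hk r s hr hrs hsr c' hc' S' hS' hcard
  have hsr2 : s - r ≤ 2 := by omega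
  -- brick 125 at the cut parameter `t − (s − r)`
  have htn' : t - (s - r) + T + 2 ≤ n := by omega
  have hτle : (((t - (s - r) : ℕ)) : ℝ) ≤ (t : ℝ) := by exact_mod_cast Nat.sub_le t (s - r)
  have hτge : (t : ℝ) - 2 ≤ (((t - (s - r) : ℕ)) : ℝ) := by
    have h1 : t - 2 ≤ t - (s - r) := by omega
    have h2 : (((t - 2 : ℕ)) : ℝ) ≤ (((t - (s - r) : ℕ)) : ℝ) := by exact_mod_cast h1
    rw [Nat.cast_sub ht2] at h2
    exact_mod_cast h2
  have hsT' : (((t - (s - r) : ℕ)) : ℝ) / 2 +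
      β * (((reps M.2.partner (vBH M.2.partner univ H ∪ vBN M.2.partner univ H)).card : ℝ) +
        (reps M.2.partner (vDD M.2.partner univ H)).card) + 2 * T + 4 * (D + 2) + 2 ≤
      ((reps M.2.partner (vBH M.2.partner univ H ∪ vBN M.2.partner univ H)).card : ℝ) +
        (reps M.2.partner (vDD M.2.partner univ H)).card := by linarith
  have h := smoothnessFamily_le_of_type M H htn' hβ hV₀ hu0 hu1 r₀ hkV hbT hdT hr₀ hsT' hV₀le hNT k hk r hr c' hc' S' hS'
    hcard
  rw [show t - (s - r) - r = t - s by omega] at h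
  refine h.trans (add_le_add le_rfl (mul_le_mul_of_nonneg_left (Real.exp_le_exp.2 ?_) (by positivity)))
  -- monotonicity of the exponent in the cut parameter
  have hM : 0 < (n : ℝ) / 2 - T - 2 := by linarith
  have ha0 : (0 : ℝ) ≤ (reps M.2.partner (vAA M.2.partner univ H)).card := Nat.cast_nonneg _
  have huu : 0 ≤ u + u ^ 2 := by positivity
  have h1 : (u + u ^ 2) * ((((t - (s - r) : ℕ)) : ℝ) / 2 * (reps M.2.partner (vAA M.2.partner univ H)).card / ((n : ℝ) / 2 - T - 2)) ≤
      (u + u ^ 2) * ((t : ℝ) / 2 * (reps M.2.partner (vAA M.2.partner univ H)).card / ((n : ℝ) / 2 - T - 2)) := by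
    refine mul_le_mul_of_nonneg_left (div_le_div_of_nonneg_right ?_ hM.le) huu
    exact mul_le_mul_of_nonneg_right (by linarith) ha0
  have h2 : u * (((t : ℝ) - T - 4) / 2 + 1 - r₀) ≤ u * (((((t - (s - r) : ℕ)) : ℝ) - T - 2) / 2 + 1 - r₀) :=
    mul_le_mul_of_nonneg_left (by linarith) hu0
  linarith

end Summit.PneNP.PneNP.Theorems.ChebyshevTracialDesignGammaDirectionByType

end
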